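import Literature.RingTheory.PBasis.KimuraNiitsuma1980
import HarnessLib

/-!
# Route `RadicialJung`, crux `CleanModels` (stmt-15917): GENERATION `R = R^p[A, x]` BY NAKAYAMA —
# piece (A2) of the T2 `p`-basis discharge

Support file (OURS) for PROGRAMME-clean-dim2 / T2 (`HOME/L/res-L0-w81-pv-2/g5/T2-ARCHITECTURE.md`).

**(A2).** Let `R` be a local ring and `T ⊆ R` a subring containing all `p`-th powers (`p ≥ 2`),
such that
* every residue class of `R` meets `T` (`∀ r, ∃ s ∈ T, r - s ∈ 𝔪`) — e.g. `T ⊇ A` where the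
  residues of `A` together with `κ^p` generate the residue field `κ`
  (`exists_sub_mem_maximalIdeal_of_adjoin_residue_eq_top`);
* the maximal ideal is generated by finitely many elements of `T`; and
* `R` is generated over `T` by finitely many further elements.

Then `T = R` (`subring_eq_top_of_nakayama`). Proof: every `t ∈ R` has `t^p ∈ T`, so `R` is a
finite `T`-module; a unit of `R` lying in `T` has its inverse `u^{p-1}·(u^{-1})^p` in `T`, so
`𝔪 ∩ T` lies in the Jacobson radical of `T`; and `R = T + 𝔪 = T + (𝔪 ∩ T)·R`, whence `R = T` by
Nakayama. This is the generation half of Kimura–Niitsuma's Theorem 3.1 ("`R = R^p[A, z₁, …, z_r]`"),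
with their hypothesis "`R` is a finite `R^p[A]`-module" in the form available at a closed point of a
variety; `subalgebra_adjoin_eq_top_of_nakayama` restates it for `Algebra.adjoin R^p Γ`, the form
used by `IsPBasisOver`.

References: T. Kimura, H. Niitsuma, *Regular local ring of characteristic p and p-basis*,
J. Math. Soc. Japan 32 (1980), Thm. 3.1 and Lemma 2.6 (c). [cite: KimuraNiitsuma1980, Thm. 3.1]
-/

noncomputable section

open IsLocalRing
open Literature.RingTheory.PBasis

namespace Summit.ResolutionOfSingularities.ResolutionOfSingularities.Theorems.RadicialJung.CleanModels

universe u

variable {R : Type u} [CommRing R] {p : ℕ} (hp : 1 ≤ p) (T : Subring R) (hT : ∀ r : R, r ^ p ∈ T)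

include hp hT in
/-- A subring containing the `p`-th powers contains the inverse of each of its elements that is a
unit of `R`: `u⁻¹ = u^{p-1} · (u⁻¹)^p`. [folklore] -/
theorem units_inv_mem_subring_of_pow_mem (u : Rˣ) (hu : (u : R) ∈ T) : ((u⁻¹ : Rˣ) : R) ∈ T := by
  have h2 : ((u⁻¹ : Rˣ) : R) = (u : R) ^ (p - 1) * ((u⁻¹ : Rˣ) : R) ^ p := by
    obtain ⟨q, hq⟩ : ∃ q, p = q + 1 := ⟨p - 1, (Nat.sub_add_cancel hp).symm⟩
    rw [hq, Nat.add_sub_cancel, pow_succ, ← mul_assoc, ← mul_pow, Units.mul_inv, one_pow, one_mul]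
  rw [h2]
  exact T.mul_mem (T.pow_mem hu _) (hT _)

include hp hT in
/-- Elements of `R` are integral over a subring containing the `p`-th powers. [folklore] -/
theorem isIntegral_subring_of_pow_mem (r : R) : IsIntegral T r := by
  refine IsIntegral.of_pow hp ?_
  have : r ^ p = algebraMap T R ⟨r ^ p, hT r⟩ := rfl
  rw [this]
  exact isIntegral_algebraMap

include hp hT in
/-- If `R` is generated over `T ⊇ R^p` by finitely many further elements, then `R` is a finite
`T`-module. [folklore] -/
theorem moduleFinite_of_closure_union_finset_eq_top (t : Finset R)
    (ht : Subring.closure ((T : Set R) ∪ ↑t) = ⊤) : Module.Finite T R := by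
  have hadj : Algebra.adjoin T (t : Set R) = ⊤ := by
    rw [← Algebra.toSubring_eq_top, Algebra.adjoin_eq_ring_closure, ← ht]
    congr 1
    ext r
    simp only [Set.mem_union, Set.mem_range, SetLike.mem_coe]
    constructor
    · rintro (⟨s, rfl⟩ | hr)
      · exact Or.inl s.2
      · exact Or.inr hr
    · rintro (hr | hr)
      · exact Or.inl ⟨⟨r, hr⟩, rfl⟩
      · exact Or.inr hr
  have hfin : Module.Finite T (Algebra.adjoin T (t : Set R)) :=
    Algebra.finite_adjoin_of_finite_of_isIntegral t.finite_toSet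
      fun r _ => isIntegral_subring_of_pow_mem hp T hT r
  rw [hadj] at hfin
  exact Module.Finite.equiv (Subalgebra.topEquiv (R := T) (A := R)).toLinearEquiv

variable [IsLocalRing R]

include hp hT in
/-- The contraction of `𝔪` to a subring `T ⊇ R^p` lies in the Jacobson radical of `T` (`T` is
local along `R`). [folklore] -/
theorem comap_maximalIdeal_le_jacobson_bot_of_pow_mem :
    (maximalIdeal R).comap (algebraMap T R) ≤ (⊥ : Ideal T).jacobson := by
  intro s hs
  rw [Ideal.mem_jacobson_bot]
  intro y
  have hs' : (s : R) ∈ maximalIdeal R := hs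
  have hunit : IsUnit ((s : R) * y + 1) := by
    by_contra h
    have hmem : (s : R) * y + 1 ∈ maximalIdeal R := (mem_maximalIdeal _).mpr h
    have h1 : (1 : R) ∈ maximalIdeal R := by
      have := sub_mem hmem (Ideal.mul_mem_right (y : R) _ hs')
      rwa [add_sub_cancel_left] at this
    exact (maximalIdeal.isMaximal R).ne_top ((Ideal.eq_top_iff_one _).mpr h1)
  obtain ⟨u, hu⟩ := hunit
  have huT : (u : R) ∈ T := by rw [hu]; exact (s * y + 1).2
  refine isUnit_iff_exists_inv.mpr
    ⟨⟨((u⁻¹ : Rˣ) : R), units_inv_mem_subring_of_pow_mem hp T hT u huT⟩, ?_⟩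
  apply Subtype.ext
  show ((s : R) * y + 1) * ((u⁻¹ : Rˣ) : R) = 1
  rw [← hu, Units.mul_inv]

include hp hT in
/-- **(A2) Generation by Nakayama**: a subring `T ⊇ R^p` of a local ring `R` meeting every
residue class, containing generators of `𝔪`, and over which `R` is generated by finitely many
elements, is all of `R`. [cite: KimuraNiitsuma1980, Thm. 3.1] -/
theorem subring_eq_top_of_nakayama (hres : ∀ r : R, ∃ s ∈ T, r - s ∈ maximalIdeal R)
    {d : ℕ} (x : Fin d → R) (hxT : ∀ i, x i ∈ T) (hx : Ideal.span (Set.range x) = maximalIdeal R)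
    (t : Finset R) (ht : Subring.closure ((T : Set R) ∪ ↑t) = ⊤) : T = ⊤ := by
  classical
  haveI : Module.Finite T R := moduleFinite_of_closure_union_finset_eq_top hp T hT t ht
  let I : Ideal T := (maximalIdeal R).comap (algebraMap T R)
  have hle : (⊤ : Submodule T R) ≤ (1 : Submodule T R) ⊔ I • (⊤ : Submodule T R) := by
    intro r _
    obtain ⟨s, hsT, hrs⟩ := hres r
    rw [← hx] at hrs
    obtain ⟨c, hc⟩ := Ideal.mem_span_range_iff_exists_fun.mp hrs
    have hr : r = s + ∑ i, c i * x i := by rw [hc]; ring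
    rw [hr]
    refine Submodule.add_mem_sup ?_ ?_
    · exact Submodule.mem_one.mpr ⟨⟨s, hsT⟩, rfl⟩
    · refine Submodule.sum_mem _ fun i _ => ?_
      have : c i * x i = (⟨x i, hxT i⟩ : T) • c i := by
        rw [Subring.smul_def, smul_eq_mul, mul_comm]
      rw [this]
      refine Submodule.smul_mem_smul ?_ Submodule.mem_top
      show (x i) ∈ maximalIdeal R
      rw [← hx]
      exact Ideal.subset_span ⟨i, rfl⟩
  have hN := Submodule.le_of_le_smul_of_le_jacobson_bot Module.Finite.fg_top
    (comap_maximalIdeal_le_jacobson_bot_of_pow_mem hp T hT) hle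
  rw [eq_top_iff]
  intro r _
  obtain ⟨s, hs⟩ := Submodule.mem_one.mp (hN (Submodule.mem_top : r ∈ (⊤ : Submodule T R)))
  rw [← hs]
  exact s.2

omit hp hT in
/-- If the residues of `A ⊆ T` together with the `p`-th powers generate the residue field, then
every residue class of `R` meets `T`. [folklore] -/
theorem exists_sub_mem_maximalIdeal_of_closure_residue_eq_top (A : Set R) (hA : A ⊆ T)
    [ExpChar (ResidueField R) p]
    (hκ : Subring.closure (Set.range (frobenius (ResidueField R) p) ∪ residue R '' A) = ⊤)
    (hT' : ∀ r : R, r ^ p ∈ T) (r : R) :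
    ∃ s ∈ T, r - s ∈ maximalIdeal R := by
  have key : ∀ z ∈ Subring.closure (Set.range (frobenius (ResidueField R) p) ∪ residue R '' A),
      ∃ s ∈ T, residue R s = z := by
    intro z hz
    refine Subring.closure_induction (p := fun z _ => ∃ s ∈ T, residue R s = z) ?_ ?_ ?_ ?_ ?_ ?_ hz
    · rintro z (⟨w, rfl⟩ | ⟨a, ha, rfl⟩)
      · obtain ⟨v, hv⟩ := residue_surjective w
        exact ⟨v ^ p, hT' v, by rw [map_pow, hv, frobenius_def]⟩
      · exact ⟨a, hA ha, rfl⟩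
    · exact ⟨0, T.zero_mem, map_zero _⟩
    · exact ⟨1, T.one_mem, map_one _⟩
    · rintro z₁ z₂ - - ⟨s₁, hs₁, rfl⟩ ⟨s₂, hs₂, rfl⟩
      exact ⟨s₁ + s₂, T.add_mem hs₁ hs₂, map_add _ _ _⟩
    · rintro z - ⟨s, hs, rfl⟩
      exact ⟨-s, T.neg_mem hs, map_neg _ _⟩
    · rintro z₁ z₂ - - ⟨s₁, hs₁, rfl⟩ ⟨s₂, hs₂, rfl⟩
      exact ⟨s₁ * s₂, T.mul_mem hs₁ hs₂, map_mul _ _ _⟩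
  obtain ⟨s, hs, hsr⟩ := key (residue R r) (by rw [hκ]; exact Subring.mem_top _)
  refine ⟨s, hs, ?_⟩
  rw [← residue_eq_zero_iff, map_sub, hsr, sub_self]

/-! ## The `Algebra.adjoin R^p Γ` form -/

omit hp hT [IsLocalRing R] in
/-- `Algebra.adjoin R^p Γ`, as a subring, is the subring generated by the `p`-th powers and `Γ`;
in particular it contains all `p`-th powers. [folklore] -/
theorem adjoin_frobenius_toSubring [ExpChar R p] (Γ : Set R) :
    (Algebra.adjoin (frobenius R p).range Γ).toSubring =
      Subring.closure (Set.range (frobenius R p) ∪ Γ) := by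
  rw [Algebra.adjoin_eq_ring_closure]
  congr 2
  ext r
  simp only [Set.mem_range]
  constructor
  · rintro ⟨⟨s, ⟨w, hw⟩⟩, rfl⟩
    exact ⟨w, hw⟩
  · rintro ⟨w, rfl⟩
    exact ⟨⟨frobenius R p w, ⟨w, rfl⟩⟩, rfl⟩

omit hp hT [IsLocalRing R] in
/-- `p`-th powers lie in `Algebra.adjoin R^p Γ`. [folklore] -/
theorem pow_mem_adjoin_frobenius [ExpChar R p] (Γ : Set R) (r : R) :
    r ^ p ∈ Algebra.adjoin (frobenius R p).range Γ :=
  Subalgebra.algebraMap_mem _ (⟨r ^ p, ⟨r, frobenius_def _ _⟩⟩ : (frobenius R p).range)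

end Summit.ResolutionOfSingularities.ResolutionOfSingularities.Theorems.RadicialJung.CleanModels
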